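import Mathlib
import Summits.Ventures.PercRepro2.TB14Fold

/-!
# The dual junction reduction of typed BHK 1.4 (single-vertex): the `a₁`-region swap
(blind cell PercRepro2, mine-c g13, 2026-08-25; MINE-C.md §22.3)

(TB14) is symmetric under `(a₁, b) ↔ (a₂, o)` (exchange the copies in the «cross» count), so the
region swap of `a₁` (`swapRegion ends F a₁`, complementing the free edges touching
`C_y(a₁) ∪ C_w(a₁)`) gives a second localisation: the (TB14) slack is the count over the
configurations in which the `a₁`-region swap cuts `o` from `a₂` (`tb14_slack_eq_junction'`), and
(TB14) holds with equality when no admissible configuration loses `o` that way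
(`tb14_of_no_junction'`).
Axioms: standard.
-/

namespace Summit.Ventures.PercRepro2

namespace TB14Fold

open CovForm A3InactiveTyped

section Dual

variable {V : Type} {E : Type} [Fintype E] [DecidableEq E] {R : Type*} [Field R]

omit [Fintype E] [DecidableEq E] in
/-- `1_Q` is symmetric in the two roots. -/
lemma iQ_symm (ends : E → Sym2 V) (a₁ a₂ : V) (ω : Config E) :
    (iQ ends a₂ a₁ ω : R) = iQ ends a₁ a₂ ω := by
  rw [iQ_eq_ite, iQ_eq_ite]
  by_cases h : Conn ends ω a₂ a₁
  · rw [if_pos (show a₁ ∈ cluster ends ω a₂ from h),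
      if_pos (show a₂ ∈ cluster ends ω a₁ from conn_symm h)]
  · rw [if_neg (show a₁ ∉ cluster ends ω a₂ from h),
      if_neg (show a₂ ∉ cluster ends ω a₁ from fun h' => h (conn_symm h'))]

omit [Fintype E] [DecidableEq E] in
/-- The «same» product with the marking `(a₂, a₁, o, b)` is the «same» product with `(a₁, a₂, b, o)`. -/
lemma sameBO_swap_marks (ends : E → Sym2 V) (a₁ a₂ b o : V) :
    (sameBO ends a₂ a₁ o b : Config E → Config E → R) = sameBO ends a₁ a₂ b o := by
  funext y w
  simp only [sameBO, iQ_symm, iL, iH]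
  ring

omit [Fintype E] [DecidableEq E] in
/-- The «cross» product with the marking `(a₂, a₁, o, b)` is the «cross» product with
`(a₁, a₂, b, o)` and the copies exchanged. -/
lemma crossBO_swap_marks (ends : E → Sym2 V) (a₁ a₂ b o : V) :
    (crossBO ends a₂ a₁ o b : Config E → Config E → R) = crossSw ends a₁ a₂ b o := by
  funext y w
  simp only [crossBO, crossSw, iQ_symm, iL, iH]
  ring

/-- **The dual junction reduction**: the (TB14) slack for `(a₁, a₂, b, o)` is the junction count of
the swapped marking `(a₂, a₁, o, b)` — the count over the configurations in which the `a₁`-region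
swap cuts `o` from `a₂`. -/
theorem tb14_slack_eq_junction' (ends : E → Sym2 V) (a₁ a₂ b o : V) (F : Finset E)
    (z : Config E) :
    pairCount F z (sameBO ends a₁ a₂ b o : Config E → Config E → R) -
      pairCount F z (crossBO ends a₁ a₂ b o) =
      pairCount F z (junctionBO ends a₂ a₁ o b F) := by
  rw [← tb14_slack_eq_junction, sameBO_swap_marks, crossBO_swap_marks, pairCount_crossSw]

/-- **(TB14) without dual junctions**: if on every admissible first copy with `a₁ ↮ a₂` in both copies
and `o ∈ C₂`, the `a₁`-region swap keeps `o` joined to `a₂`, then the (TB14) inequality holds at the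
profile — with equality. -/
theorem tb14_of_no_junction' (ends : E → Sym2 V) (a₁ a₂ b o : V) (F : Finset E) (z : Config E)
    (h : ∀ y : Config E, (∀ e, e ∉ F → y e = z e) → ¬ Conn ends y a₁ a₂ →
      ¬ Conn ends (A3InactiveTyped.flipOn F y) a₁ a₂ → Conn ends y a₂ o →
      Conn ends (swapRegion ends F a₁ y) a₂ o) :
    pairCount F z (sameBO ends a₁ a₂ b o : Config E → Config E → R) =
      pairCount F z (crossBO ends a₁ a₂ b o) := by
  have := tb14_of_no_junction (R := R) ends a₂ a₁ o b F z h
  rwa [sameBO_swap_marks, crossBO_swap_marks, pairCount_crossSw] at this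

end Dual

end TB14Fold

end Summit.Ventures.PercRepro2
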